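import Summits.CriticalPhenomena.PercolationContinuityZ3.Theorems.PercNearOneGluingNoHeavyLowerTailSunflowerUpReaderExact
import HarnessLib
import HarnessLib.Audit

/-!
# `NoHeavyLowerTail` (crux stmt-CriticalPhenomena-4575), abstract sunflower cubic: CUBE DUALITY and the EXACT DOWN-READER (the `A`-side mirror of
# `nu_read_up_exact`: reading of the `(3|0)`-kernel vectors `μ_Q` of a cube by `Λ*_{Q0}`, with its junk over the CO-RIVALS of `Q0`)

Support file (seat `prim-l12-p2` gen 24; `--supports stmt-CriticalPhenomena-4575`).  No `sorry`, no new definitions.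
Memo: run/shared/lean/prim/prim-l12/prim-l12-p2/FINDING-g24-LOCAL-ASSIGNMENT.md (§5(1), now done).
* `Sunflower.exists_cubeDual` — CUBE DUALITY: for every cube `W` there is a sunflower `G` with `G.lab S = 4 − F.lab (W ∖ S)` (complement inside `W`,
  reverse `M₃`, petals `1 ↔ 3`); stated as an existence theorem (no definition) and used only to transport identities.  This answers gen 23's open
  item "dualise the up-reader to the A-side" without re-running the five exchanges of summation.
* `Sunflower.mu_read_down_exact` — for `Q0, Q' ⊆ W` with `lab (W∖Q0) = 0`, `lab Q' = 3`, and `Λ*_{Q0} := Σ_{Y ⊆ Q0, lab Y = 0} col_{W∖Y}`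
  (`col_Z(X) = #{R ∈ A : Z ⊆ R ⊆ X}`, the `N`-type functional, at the kernel side `X = W∖O`), `μ_{Q'}(O) = #{R' ∈ B : O ⊆ R' ⊆ Q'}`:
  `⟨Λ*_{Q0}, μ_{Q'}⟩ = [Q' ⊆ Q0] + Σ_{T ⊆ W, lab T = 3} #{R1 ∈ B : W∖T ⊆ R1 ⊆ Q0} · #{R' ∈ B : R' ⊆ Q' ∩ T}` (mod 2) — junk supported on the
  CO-RIVALS `T` of `Q0` (`lab T = 3`, `W∖T` bottom, `T ∪ Q0 = W`).  Proof: `nu_read_up_exact` for the cube dual, every index complemented in `W`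
  (`HallGladkov.sum_powerset_compl`).
* Used by `…SunflowerLocalAssignmentDual`: co-junk-free KERNEL slots are independent inside their cube, and the two-sided class theorem.
-/

namespace Summit.CriticalPhenomena.PercolationContinuityZ3.Theorems.SunflowerPartition

open Finset

variable {α : Type*} [Fintype α] [DecidableEq α]

namespace Sunflower

variable (F : Sunflower α)

/-- **THE CUBE DUAL** (this work).  For every cube `W` there is a sunflower `G` on the same ground set with `G.lab S = 4 − F.lab (W ∖ S)` for all `S`:
complementation inside `W` reverses inclusion and `v ↦ 4 − v` reverses `M₃` (swapping the petals `1 ↔ 3`), so the composite is again a monotone map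
to `M₃`; concretely `G.V i = {S : lab (W ∖ S) ∈ {0, 3 − i}}`.  (Stated as an existence theorem so that this file carries no definition; the
dual is only used to transport cube identities.) [this work] -/
theorem exists_cubeDual (W : Finset α) : ∃ G : Sunflower α, ∀ S : Finset α, G.lab S = 4 - F.lab (W \ S) := by
  classical
  have n4 : ∀ i : Fin 3, ¬ ((4 : Fin 5).val + i.val = 3) := by decide
  have n01 : ∀ v : Fin 5, ¬ (v.val + (0 : Fin 3).val = 3 ∧ v.val + (1 : Fin 3).val = 3) := by decide
  let Vd : Fin 3 → Finset (Finset α) :=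
    fun i => (Finset.univ : Finset (Finset α)).filter (fun S => F.lab (W \ S) = 0 ∨ (F.lab (W \ S)).val + i.val = 3)
  have hVd : ∀ i S, S ∈ Vd i ↔ (F.lab (W \ S) = 0 ∨ (F.lab (W \ S)).val + i.val = 3) := by
    intro i S; simp only [Vd, mem_filter, mem_univ, true_and]
  refine ⟨{ V := Vd, upper := ?_, inter_eq := ?_ }, ?_⟩
  · intro i S T hST hS
    rw [Finset.mem_coe, hVd] at hS ⊢
    have hsub : W \ T ⊆ W \ S := sdiff_subset_sdiff subset_rfl hST
    rcases F.lab_mono hsub with h | h | h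
    · rw [h]; exact hS
    · exact Or.inl h
    · rcases hS with h0 | h1
      · rw [h] at h0; exact absurd h0 (by decide)
      · rw [h] at h1; exact absurd h1 (n4 i)
  · intro i j hij
    ext S
    rw [mem_inter, mem_inter, hVd, hVd, hVd, hVd]
    have hij' : i.val ≠ j.val := fun h => hij (Fin.ext h)
    constructor
    · rintro ⟨hi, hj⟩
      have h0 : F.lab (W \ S) = 0 := by
        rcases hi with h | h
        · exact h
        · rcases hj with h' | h'
          · exact h'
          · exact absurd (by omega : i.val = j.val) hij'
      exact ⟨Or.inl h0, Or.inl h0⟩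
    · rintro ⟨hi, hj⟩
      have h0 : F.lab (W \ S) = 0 := by
        rcases hi with h | h
        · exact h
        · rcases hj with h' | h'
          · exact h'
          · exact absurd ⟨h, h'⟩ (n01 _)
      exact ⟨Or.inl h0, Or.inl h0⟩
  · intro S
    show (if S ∈ Vd 0 ∩ Vd 1 then (4 : Fin 5) else if S ∈ Vd 0 then 1 else if S ∈ Vd 1 then 2 else if S ∈ Vd 2 then 3 else 0)
      = 4 - F.lab (W \ S)
    simp only [mem_inter, hVd]
    generalize F.lab (W \ S) = v
    fin_cases v <;> decide

omit [Fintype α] in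
/-- For `B ⊆ W`: `W ∖ A ⊆ W ∖ B ↔ B ⊆ A`. [folklore] -/
theorem sdiff_subset_sdiff_iff_of_subset {A B W : Finset α} (hB : B ⊆ W) : W \ A ⊆ W \ B ↔ B ⊆ A := by
  constructor
  · intro h x hxB
    by_contra hxA
    exact (mem_sdiff.1 (h (mem_sdiff.2 ⟨hB hxB, hxA⟩))).2 hxB
  · intro h x hx
    exact mem_sdiff.2 ⟨(mem_sdiff.1 hx).1, fun hxB => (mem_sdiff.1 hx).2 (h hxB)⟩

omit [Fintype α] in
/-- For `A, B ⊆ W`: `A ⊆ W ∖ B ↔ B ⊆ W ∖ A`. [folklore] -/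
theorem subset_sdiff_comm_of_subset {A B W : Finset α} (hA : A ⊆ W) (hB : B ⊆ W) : A ⊆ W \ B ↔ B ⊆ W \ A := by
  constructor
  · intro h x hxB; exact mem_sdiff.2 ⟨hB hxB, fun hxA => (mem_sdiff.1 (h hxA)).2 hxB⟩
  · intro h x hxA; exact mem_sdiff.2 ⟨hA hxA, fun hxB => (mem_sdiff.1 (h hxB)).2 hxA⟩

omit [Fintype α] in
/-- For `A, B ⊆ W`: `W ∖ A ⊆ B ↔ W ∖ B ⊆ A`. [folklore] -/
theorem sdiff_subset_comm_of_subset {A B W : Finset α} : W \ A ⊆ B ↔ W \ B ⊆ A := by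
  constructor
  · intro h x hx
    by_contra hxA
    exact (mem_sdiff.1 hx).2 (h (mem_sdiff.2 ⟨(mem_sdiff.1 hx).1, hxA⟩))
  · intro h x hx
    by_contra hxB
    exact (mem_sdiff.1 hx).2 (h (mem_sdiff.2 ⟨(mem_sdiff.1 hx).1, hxB⟩))

/-- **THE EXACT DOWN-READER** (this work; the cube dual of `nu_read_up_exact`).  Let `Q0, Q' ⊆ W` with `lab (W ∖ Q0) = 0` and `lab Q' = 3`, and let
`Λ*_{Q0} := Σ_{Y ⊆ Q0, lab Y = 0} col_{W∖Y}` (`col_Z(X) = #{R ∈ A : Z ⊆ R ⊆ X}`, the `N`-type functional of `Z`, at the kernel side `X = W ∖ O` of a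
kernel–bottom pair `O`).  Then its pairing with `μ_{Q'}` (`μ_{Q'}(O) = #{R' ∈ B : O ⊆ R' ⊆ Q'}`) is
`[Q' ⊆ Q0] + Σ_{T ⊆ W, lab T = 3} #{R1 ∈ B : W∖T ⊆ R1 ⊆ Q0} · #{R' ∈ B : R' ⊆ Q' ∩ T}` (mod 2) — junk supported on the CO-RIVALS of `Q0`
(`lab T = 3`, `W ∖ T` bottom, `T ∪ Q0 = W`).  Obtained from `nu_read_up_exact` for `F.cubeDual W` by complementing every index. [this work] -/
theorem mu_read_down_exact (W : Finset α) {Q0 Q' : Finset α} (hQ0 : Q0 ⊆ W) (hQ' : Q' ⊆ W)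
    (hcQ0 : F.lab (W \ Q0) = 0) (hQ'3 : F.lab Q' = 3) :
    (∑ Y ∈ Q0.powerset, (if F.lab Y = 0 then
        ∑ O ∈ W.powerset,
          (∑ R ∈ W.powerset, (if F.lab R = 4 ∧ W \ Y ⊆ R ∧ R ⊆ W \ O then (1 : ZMod 2) else 0)) *
          (∑ R' ∈ W.powerset, (if F.lab R' = 0 ∧ O ⊆ R' ∧ R' ⊆ Q' then (1 : ZMod 2) else 0)) else 0))
      = (if Q' ⊆ Q0 then 1 else 0)
        + ∑ T ∈ W.powerset, (if F.lab T = 3 then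
            (∑ R1 ∈ W.powerset, (if F.lab R1 = 0 ∧ R1 ⊆ Q0 ∧ W \ T ⊆ R1 then (1 : ZMod 2) else 0)) *
            (∑ R' ∈ W.powerset, (if F.lab R' = 0 ∧ R' ⊆ Q' ∧ R' ⊆ T then (1 : ZMod 2) else 0)) else 0) := by
  have e0 : ∀ v : Fin 5, (4 - v = 0 ↔ v = 4) := by decide
  have e4 : ∀ v : Fin 5, (4 - v = 4 ↔ v = 0) := by decide
  have e1 : ∀ v : Fin 5, (4 - v = 1 ↔ v = 3) := by decide
  obtain ⟨G, hG⟩ := F.exists_cubeDual W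
  have hP0 : G.lab (W \ (W \ Q0)) = 4 := by
    rw [hG, Finset.sdiff_sdiff_eq_self sdiff_subset, hcQ0]; decide
  have hP' : G.lab (W \ Q') = 1 := by
    rw [hG, Finset.sdiff_sdiff_eq_self hQ', hQ'3]; decide
  have h := G.nu_read_up_exact W (P0 := W \ Q0) (P' := W \ Q') sdiff_subset sdiff_subset hP0 hP'
  simp only [hG, e0, e4, e1] at h
  rw [Finset.sdiff_sdiff_eq_self hQ0] at h
  -- the two inner sums of the left-hand side, complemented
  have innerA : ∀ O ∈ W.powerset, ∀ Y ∈ Q0.powerset,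
      (∑ R ∈ W.powerset, (if F.lab R = 4 ∧ W \ Y ⊆ R ∧ R ⊆ W \ O then (1 : ZMod 2) else 0))
        = ∑ R' ∈ W.powerset, (if F.lab (W \ R') = 4 ∧ O ⊆ R' ∧ R' ⊆ Y then (1 : ZMod 2) else 0) := by
    intro O hO Y hY
    have hOW : O ⊆ W := mem_powerset.1 hO
    rw [← HallGladkov.sum_powerset_compl W (fun R' => if F.lab (W \ R') = 4 ∧ O ⊆ R' ∧ R' ⊆ Y then (1 : ZMod 2) else 0)]
    refine sum_congr rfl fun R hR => ?_
    have hRW : R ⊆ W := mem_powerset.1 hR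
    simp only [Finset.sdiff_sdiff_eq_self hRW]
    by_cases hc : F.lab R = 4 ∧ W \ Y ⊆ R ∧ R ⊆ W \ O
    · rw [if_pos hc, if_pos ⟨hc.1, (subset_sdiff_comm_of_subset hRW hOW).1 hc.2.2, sdiff_subset_comm_of_subset.2 hc.2.1⟩]
    · rw [if_neg hc, if_neg fun h' => hc ⟨h'.1, sdiff_subset_comm_of_subset.1 h'.2.2, (subset_sdiff_comm_of_subset hOW hRW).1 h'.2.1⟩]
  have innerB : ∀ O ∈ W.powerset,
      (∑ R' ∈ W.powerset, (if F.lab R' = 0 ∧ O ⊆ R' ∧ R' ⊆ Q' then (1 : ZMod 2) else 0))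
        = ∑ R ∈ W.powerset, (if F.lab (W \ R) = 0 ∧ W \ Q' ⊆ R ∧ R ⊆ W \ O then (1 : ZMod 2) else 0) := by
    intro O hO
    have hOW : O ⊆ W := mem_powerset.1 hO
    rw [← HallGladkov.sum_powerset_compl W (fun R => if F.lab (W \ R) = 0 ∧ W \ Q' ⊆ R ∧ R ⊆ W \ O then (1 : ZMod 2) else 0)]
    refine sum_congr rfl fun R' hR' => ?_
    have hR'W : R' ⊆ W := mem_powerset.1 hR'
    simp only [Finset.sdiff_sdiff_eq_self hR'W]
    by_cases hc : F.lab R' = 0 ∧ O ⊆ R' ∧ R' ⊆ Q'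
    · rw [if_pos hc, if_pos ⟨hc.1, (sdiff_subset_sdiff_iff_of_subset hR'W).2 hc.2.2, (sdiff_subset_sdiff_iff_of_subset hOW).2 hc.2.1⟩]
    · rw [if_neg hc, if_neg fun h' => hc ⟨h'.1, (sdiff_subset_sdiff_iff_of_subset hOW).1 h'.2.2, (sdiff_subset_sdiff_iff_of_subset hR'W).1 h'.2.1⟩]
  have hL : (∑ Y ∈ Q0.powerset, (if F.lab Y = 0 then
        ∑ O ∈ W.powerset,
          (∑ R ∈ W.powerset, (if F.lab R = 4 ∧ W \ Y ⊆ R ∧ R ⊆ W \ O then (1 : ZMod 2) else 0)) *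
          (∑ R' ∈ W.powerset, (if F.lab R' = 0 ∧ O ⊆ R' ∧ R' ⊆ Q' then (1 : ZMod 2) else 0)) else 0))
      = ∑ Y ∈ Q0.powerset, (if F.lab (W \ (W \ Y)) = 0 then
        ∑ O ∈ W.powerset,
          (∑ R' ∈ W.powerset, (if F.lab (W \ R') = 4 ∧ O ⊆ R' ∧ R' ⊆ Y then (1 : ZMod 2) else 0)) *
          (∑ R ∈ W.powerset, (if F.lab (W \ R) = 0 ∧ W \ Q' ⊆ R ∧ R ⊆ W \ O then (1 : ZMod 2) else 0)) else 0) := by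
    refine sum_congr rfl fun Y hY => ?_
    have hYW : Y ⊆ W := (mem_powerset.1 hY).trans hQ0
    rw [Finset.sdiff_sdiff_eq_self hYW]
    by_cases hY0 : F.lab Y = 0
    · rw [if_pos hY0, if_pos hY0]
      exact sum_congr rfl fun O hO => by rw [innerA O hO Y hY, innerB O hO]
    · rw [if_neg hY0, if_neg hY0]
  -- the junk, complemented
  have junkA : ∀ T ∈ W.powerset,
      (∑ R1 ∈ W.powerset, (if F.lab R1 = 0 ∧ R1 ⊆ Q0 ∧ W \ T ⊆ R1 then (1 : ZMod 2) else 0))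
        = ∑ R1 ∈ W.powerset, (if F.lab (W \ R1) = 0 ∧ W \ Q0 ⊆ R1 ∧ W \ T ⊆ W \ R1 then (1 : ZMod 2) else 0) := by
    intro T hT
    rw [← HallGladkov.sum_powerset_compl W (fun R1 => if F.lab (W \ R1) = 0 ∧ W \ Q0 ⊆ R1 ∧ W \ T ⊆ W \ R1 then (1 : ZMod 2) else 0)]
    refine sum_congr rfl fun R1 hR1 => ?_
    have hR1W : R1 ⊆ W := mem_powerset.1 hR1
    simp only [Finset.sdiff_sdiff_eq_self hR1W]
    by_cases hc : F.lab R1 = 0 ∧ R1 ⊆ Q0 ∧ W \ T ⊆ R1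
    · rw [if_pos hc, if_pos ⟨hc.1, (sdiff_subset_sdiff_iff_of_subset hR1W).2 hc.2.1, hc.2.2⟩]
    · rw [if_neg hc, if_neg fun h' => hc ⟨h'.1, (sdiff_subset_sdiff_iff_of_subset hR1W).1 h'.2.1, h'.2.2⟩]
  have junkB : ∀ T ∈ W.powerset,
      (∑ R' ∈ W.powerset, (if F.lab R' = 0 ∧ R' ⊆ Q' ∧ R' ⊆ T then (1 : ZMod 2) else 0))
        = ∑ R ∈ W.powerset, (if F.lab (W \ R) = 0 ∧ W \ Q' ⊆ R ∧ W \ T ⊆ R then (1 : ZMod 2) else 0) := by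
    intro T hT
    have hTW : T ⊆ W := mem_powerset.1 hT
    rw [← HallGladkov.sum_powerset_compl W (fun R => if F.lab (W \ R) = 0 ∧ W \ Q' ⊆ R ∧ W \ T ⊆ R then (1 : ZMod 2) else 0)]
    refine sum_congr rfl fun R' hR' => ?_
    have hR'W : R' ⊆ W := mem_powerset.1 hR'
    simp only [Finset.sdiff_sdiff_eq_self hR'W]
    by_cases hc : F.lab R' = 0 ∧ R' ⊆ Q' ∧ R' ⊆ T
    · rw [if_pos hc, if_pos ⟨hc.1, (sdiff_subset_sdiff_iff_of_subset hR'W).2 hc.2.1, (sdiff_subset_sdiff_iff_of_subset hR'W).2 hc.2.2⟩]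
    · rw [if_neg hc, if_neg fun h' => hc ⟨h'.1, (sdiff_subset_sdiff_iff_of_subset hR'W).1 h'.2.1, (sdiff_subset_sdiff_iff_of_subset hR'W).1 h'.2.2⟩]
  have hJ : (∑ T ∈ W.powerset, (if F.lab T = 3 then
            (∑ R1 ∈ W.powerset, (if F.lab R1 = 0 ∧ R1 ⊆ Q0 ∧ W \ T ⊆ R1 then (1 : ZMod 2) else 0)) *
            (∑ R' ∈ W.powerset, (if F.lab R' = 0 ∧ R' ⊆ Q' ∧ R' ⊆ T then (1 : ZMod 2) else 0)) else 0))
      = ∑ T ∈ W.powerset, (if F.lab (W \ T) = 3 then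
            (∑ R1 ∈ W.powerset, (if F.lab (W \ R1) = 0 ∧ W \ Q0 ⊆ R1 ∧ T ⊆ W \ R1 then (1 : ZMod 2) else 0)) *
            (∑ R ∈ W.powerset, (if F.lab (W \ R) = 0 ∧ W \ Q' ⊆ R ∧ T ⊆ R then (1 : ZMod 2) else 0)) else 0) := by
    rw [← HallGladkov.sum_powerset_compl W (fun T => if F.lab (W \ T) = 3 then
            (∑ R1 ∈ W.powerset, (if F.lab (W \ R1) = 0 ∧ W \ Q0 ⊆ R1 ∧ T ⊆ W \ R1 then (1 : ZMod 2) else 0)) *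
            (∑ R ∈ W.powerset, (if F.lab (W \ R) = 0 ∧ W \ Q' ⊆ R ∧ T ⊆ R then (1 : ZMod 2) else 0)) else 0)]
    refine sum_congr rfl fun T hT => ?_
    have hTW : T ⊆ W := mem_powerset.1 hT
    simp only [Finset.sdiff_sdiff_eq_self hTW]
    by_cases hT3 : F.lab T = 3
    · rw [if_pos hT3, if_pos hT3, junkA T hT, junkB T hT]
    · rw [if_neg hT3, if_neg hT3]
  have h1 : (if Q' ⊆ Q0 then (1 : ZMod 2) else 0) = if W \ Q0 ⊆ W \ Q' then 1 else 0 := by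
    by_cases hc : Q' ⊆ Q0
    · rw [if_pos hc, if_pos ((sdiff_subset_sdiff_iff_of_subset hQ').2 hc)]
    · rw [if_neg hc, if_neg fun h' => hc ((sdiff_subset_sdiff_iff_of_subset hQ').1 h')]
  rw [hL, h, hJ, h1]

end Sunflower

end Summit.CriticalPhenomena.PercolationContinuityZ3.Theorems.SunflowerPartition
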